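import Literature.Geometry.GeometricMeasureTheory.DilationInvariance
import HarnessLib

/-!
# Restricting admissible rectifiable data to a smaller open set

For the currents of integration `[W, θ, ξ]` of `Currents.lean` with admissible data on `Ω`
(`IsRectifiableData`, after [Federer1969, 4.1.28 (4)]) and an open `Ω' ≤ Ω`:

* `IsRectifiableData.inter_of_le` — `(W ∩ Ω', θ, ξ)` are admissible data on `Ω'` (the approximate
  tangent cones of `𝓗^m ⌞ (W ∩ Ω')` at points of `Ω'` are those of `𝓗^m ⌞ W`, locality
  `approxTangentCone_restrict_inter_eq_of_isOpen`);
* `currentOfIntegration_inter_eq_of_le` — and on `Ω'` the current `[W ∩ Ω', θ, ξ]` IS `[W, θ, ξ]`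
  (read on `Ω'`, i.e. Federer's `T|Ω'`): test forms on `Ω'` vanish off `Ω'`.

Hence `Current.IsLocallyRectifiable` passes to `T|Ω'` with the cut-down carrier, and the mass formula
of `MassFormula.lean` computes `𝐌(T|Ω') = ∫_{W ∩ Ω'} |θ| d𝓗^m`. No definitions, no named facts.

## References

* H. Federer, *Geometric Measure Theory*, Springer 1969, 4.1.7, 4.1.28 [Federer1969].
-/

open scoped ENNReal NNReal Topology
open MeasureTheory MeasureTheory.Measure TopologicalSpace Set Filter Metric

namespace Literature.Geometry.GeometricMeasureTheory

-- Nested operator-norm instances on (duals of) `E [⋀^Fin m]→L[ℝ] ℝ`, as in `Currents.lean`.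
set_option maxSynthPendingDepth 2

variable {V : Type*} [NormedAddCommGroup V] [InnerProductSpace ℝ V] [MeasurableSpace V]
  [BorelSpace V] {Ω Ω' : Opens V} {m : ℕ}

/-- **Admissible data restrict to smaller open sets**: if `(W, θ, ξ)` are admissible rectifiable
data on `Ω` and `Ω' ≤ Ω` then `(W ∩ Ω', θ, ξ)` are admissible on `Ω'`. [cite: Federer1969, 4.1.28 (4)] -/
theorem IsRectifiableData.inter_of_le {W : Set V} {θ : V → ℤ} {ξ : V → Fin m → V}
    (h : IsRectifiableData Ω m W θ ξ) (hle : Ω' ≤ Ω) :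
    IsRectifiableData Ω' m (W ∩ (Ω' : Set V)) θ ξ := by
  obtain ⟨hmeas, -, hrect, hint, hae⟩ := h
  refine ⟨hmeas.inter Ω'.isOpen.measurableSet, Set.inter_subset_right, hrect.mono Set.inter_subset_left,
    ?_, ?_⟩
  · intro x hx
    obtain ⟨u, hu, hu'⟩ := (hint.mono_set hle) x hx
    exact ⟨u, hu, hu'.mono_measure (Measure.restrict_mono Set.inter_subset_left le_rfl)⟩
  · have h1 : ∀ᵐ x ∂((μHE[m] : Measure V).restrict (W ∩ (Ω' : Set V))), x ∈ W ∩ (Ω' : Set V) :=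
      ae_restrict_mem (hmeas.inter Ω'.isOpen.measurableSet)
    filter_upwards [ae_mono (Measure.restrict_mono Set.inter_subset_left le_rfl) hae, h1]
      with x hx hxm
    refine ⟨hx.1, ?_⟩
    rw [hx.2, approxTangentCone_restrict_inter_eq_of_isOpen _ hmeas Ω'.isOpen hxm.2]

/-- **`[W ∩ Ω', θ, ξ] = [W, θ, ξ]` on `Ω'`** (`Ω' ≤ Ω`, data locally summable on `Ω`): a test form
on `Ω'` vanishes off `Ω'`, so cutting the carrier down to `Ω'` does not change the current read on
`Ω'` (Federer's restriction `T|Ω'`). [cite: Federer1969, 4.1.7] -/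
theorem currentOfIntegration_inter_eq_of_le {W : Set V} (hW : MeasurableSet W) {θ : V → ℤ}
    {ξ : V → Fin m → V} (hle : Ω' ≤ Ω)
    (hint : LocallyIntegrableOn (fun x => (θ x : ℝ) • frameVector (ξ x)) (Ω : Set V)
      ((μHE[m] : Measure V).restrict W)) :
    (currentOfIntegration (W ∩ (Ω' : Set V)) θ ξ : Current Ω' m) =
      (currentOfIntegration W θ ξ : Current Ω' m) := by
  have h₂ : LocallyIntegrableOn (fun x => (θ x : ℝ) • frameVector (ξ x)) (Ω' : Set V)
      ((μHE[m] : Measure V).restrict W) := hint.mono_set hle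
  have h₁ : LocallyIntegrableOn (fun x => (θ x : ℝ) • frameVector (ξ x)) (Ω' : Set V)
      ((μHE[m] : Measure V).restrict (W ∩ (Ω' : Set V))) := by
    intro x hx
    obtain ⟨u, hu, hu'⟩ := h₂ x hx
    exact ⟨u, hu, hu'.mono_measure (Measure.restrict_mono Set.inter_subset_left le_rfl)⟩
  ext φ
  rw [currentOfIntegration_apply h₁, currentOfIntegration_apply h₂]
  refine (setIntegral_eq_of_subset_of_forall_sdiff_eq_zero hW Set.inter_subset_left ?_).symm
  rintro x ⟨hxW, hxU⟩
  have hx : x ∉ tsupport ⇑φ := fun h => hxU ⟨hxW, φ.tsupport_subset h⟩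
  rw [image_eq_zero_of_notMem_tsupport hx, ContinuousAlternatingMap.coe_zero, Pi.zero_apply, mul_zero]

/-- Hence a current of integration with admissible data on `Ω` is locally rectifiable when read on
any `Ω' ≤ Ω`, with the cut-down data. [cite: Federer1969, 4.1.28] -/
theorem IsRectifiableData.isLocallyRectifiable_of_le {W : Set V} {θ : V → ℤ} {ξ : V → Fin m → V}
    (h : IsRectifiableData Ω m W θ ξ) (hle : Ω' ≤ Ω) :
    (currentOfIntegration W θ ξ : Current Ω' m).IsLocallyRectifiable :=
  ⟨_, _, _, h.inter_of_le hle, (currentOfIntegration_inter_eq_of_le h.1 hle h.2.2.2.1).symm⟩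

end Literature.Geometry.GeometricMeasureTheory
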